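import Literature.NumberTheory.Transcendental.RoySmallValueEstimatesProp15Proofs
import Literature.NumberTheory.Transcendental.RoySmallValueEstimatesProp14ConjProofs
import Literature.NumberTheory.Transcendental.RoySmallValueEstimatesNotInProofs
import Mathlib.Data.Nat.Log
import HarnessLib

/-!
# Small value estimates at rational translates (Nguyen–Roy 2016) — proofs: the data attached to a level `D` (§5 assembled)

Proofs file towards `Literature.NumberTheory.Transcendental.nguyenRoy2016_thm_1` (Nguyen–Roy, IJNT 12
(2016) = arXiv:1412.5163). Everything here is PROVED; no named facts. Source, §5 (pp. 11–12):

> Throughout this section, we assume that the hypotheses of Theorem 1 hold [...] with `r ≠ 0` and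
> `|s| > 1` [...] We also fix a choice of polynomials `P̃_D` as in Proposition 4, say one for each
> integer `D ≥ D₀` [...] `W_D = 𝒵(Φⁱ(P̃_D); 0 ≤ i < 2⌊D^σ⌋)` [...] `𝒞_D = {P ∈ ℂ[X]_D ; ‖P‖ ≤
> e^{2D^β}, max_{0≤i<⌊D^σ⌋} |P(γ̲ᵢ)| ≤ e^{−(1/2)D^ν}}` [...] (Propositions 14, 15, Corollary 16).

Given the sequence `P̃_D` (`Pt : ℕ → ℤ[X₀,X₁,X₂]`) with the properties of Proposition 4 at the
level `D` (`NguyenRoy.PropsAt`, `NguyenRoy.SuppAt` of `RoySmallValueEstimatesNotInProofs`), this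
file assembles the objects of §5 at that level and proves the three `D`-indexed suppliers of
`NguyenRoy.EndgameData` with SYMBOLIC largeness hypotheses (the "for `D` large enough" numerics
are discharged in the final assembly):

* parameters `Tl σ D = ⌊D^σ⌋`, `Lc` (interpolation level, `T ≤ binom(Lc+2, 2)`), `kl`
  (`D² ≤ 2^{kl}`), `Yl = 3D^β`, `Ul = D^ν/4`, `S0` (the bound of Proposition 15);
  `intModel` — the integer models of `ΦⁱP̃_D` (`i < 4⌊D^σ⌋`) and their properties, `intModel_zero`;
* memberships in `𝒞 = nrBody D ξ η r s Yl Ul Tl`: `map_Pt_mem_nrBody`, `map_intModel_mem_nrBody`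
  (`i < 2T`, values at `γ_{i+j}`), `map_compQ_mem_nrBody` (the companion `Q`, under the slack
  hypotheses `D(D²)^D e^{2D^β} ≤ e^{Yl}`, `D(D²)^D e^{−D^ν/2} ≤ e^{−Ul}`);
* `exists_transPkg_level` — the pair package of `(P̃_D, Q)`; **`LevelSel`** — a selected orbit with
  the conclusions of Proposition 15 (`exists_levelSel`, from `PairPkg.exists_orb_prod_le'` and
  `eval_rep_eq_zero_of_orbit_bound`);
* **`LevelSel.isIn`** — `Z_D ⊆ W_D` (`NguyenRoy.IsIn`); **`LevelSel.cor16`** — Corollary 16 in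
  symbolic form; **`prop14_card_le`, `prop14_ht_le_of_isIn`** — Proposition 14 for any `Z ⊆ W_D`
  (`hW_of_isIn`: the pointwise vanishing at all conjugates and translates from `IsIn`).

## References

* [NguyenRoy2016] N. A. V. Nguyen, D. Roy, IJNT 12 (2016) 1273–1293 = arXiv:1412.5163, §5
  (Propositions 14, 15, Corollary 16) and Proposition 4.
-/

noncomputable section

open MvPolynomial Finset Module Height NumberField
open scoped Matrix Classical

namespace Literature.NumberTheory.Transcendental

namespace NguyenRoy

open Roy2013
open Nesterenko hiding tau

/-! ### The parameters of a level -/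

/-- `T = ⌊D^σ⌋`. [cite: NguyenRoy2016, §5 (Proposition 14: `T = ⌊D^σ⌋`)] -/
def Tl (σ : ℝ) (D : ℕ) : ℕ := ⌊(D : ℝ) ^ σ⌋₊

/-- The interpolation level `L` with `T ≤ binom(L+2, 2)` (`L = ⌊√(2T)⌋ + 1`).
[cite: NguyenRoy2016, proof of Corollary 16 ("`T ≤ D^σ ≤ binom(D+1,2)`") and Proposition 8] -/
def Lc (σ : ℝ) (D : ℕ) : ℕ := Nat.sqrt (2 * Tl σ D) + 1

/-- `k` with `D² ≤ 2^k`. [folklore] -/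
def kl (D : ℕ) : ℕ := Nat.clog 2 (D ^ 2)

/-- `Y = 3D^β` (the paper's `Y = 2D^β` with room for the companion `Q` and the interpolation
constant). [cite: NguyenRoy2016, proof of Proposition 15 (`Y = 2D^β`)] -/
def Yl (β : ℝ) (D : ℕ) : ℝ := 3 * (D : ℝ) ^ β

/-- `U = D^ν/4` (the paper's `U = D^ν/2` with room for the companion `Q`).
[cite: NguyenRoy2016, proof of Proposition 15 (`U = (1/2)D^ν`)] -/
def Ul (ν : ℝ) (D : ℕ) : ℝ := (D : ℝ) ^ ν / 4

/-- The bound `S₀ = 2^{2k2^k} e^{−TU} N!(3e^Y)^N` of Proposition 15 in test-family form.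
[cite: NguyenRoy2016, proof of Proposition 15] -/
def S0 (σ β ν : ℝ) (D : ℕ) : ℝ :=
  2 ^ (2 * kl D * 2 ^ kl D) * (Real.exp (-(Tl σ D * Ul ν D)) *
    ((Fintype.card (PhiRow D)).factorial * (3 * Real.exp (Yl β D)) ^ Fintype.card (PhiRow D)))

/-- `0 < S₀`. [folklore] -/
theorem S0_pos (σ β ν : ℝ) (D : ℕ) : 0 < S0 σ β ν D := by
  unfold S0; positivity

/-- `D ≤ T = ⌊D^σ⌋` for `σ ≥ 1`. [folklore] -/
theorem le_Tl {σ : ℝ} (hσ : 1 ≤ σ) (D : ℕ) : D ≤ Tl σ D := by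
  rcases Nat.eq_zero_or_pos D with rfl | hD
  · exact Nat.zero_le _
  · refine Nat.le_floor ?_
    have h1 : (1 : ℝ) ≤ D := by exact_mod_cast hD
    calc (D : ℝ) = (D : ℝ) ^ (1 : ℝ) := (Real.rpow_one _).symm
      _ ≤ (D : ℝ) ^ σ := Real.rpow_le_rpow_of_exponent_le h1 hσ

/-- `1 ≤ T` for `D ≥ 1`, `σ ≥ 0`. [folklore] -/
theorem one_le_Tl {σ : ℝ} (hσ : 0 ≤ σ) {D : ℕ} (hD : 1 ≤ D) : 1 ≤ Tl σ D := by
  refine Nat.le_floor ?_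
  rw [Nat.cast_one]
  exact Real.one_le_rpow (by exact_mod_cast hD) hσ

/-- `T ≤ (L+1)(L+2)/2`. [folklore] -/
theorem Tl_le_mul (σ : ℝ) (D : ℕ) : Tl σ D ≤ (Lc σ D + 1) * (Lc σ D + 2) / 2 := by
  set T := Tl σ D
  set q := Nat.sqrt (2 * T) with hq
  have h1 : 2 * T < (q + 1) * (q + 1) := Nat.lt_succ_sqrt (2 * T)
  rw [Lc, ← hq]
  have h2 : (q + 1) * (q + 1) ≤ (q + 1 + 1) * (q + 1 + 2) := by nlinarith
  have h3 : 2 * T + 1 ≤ (q + 1 + 1) * (q + 1 + 2) := by omega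
  omega

/-- `T ≤ binom(L+2, 2)`. [folklore] -/
theorem Tl_le_choose (σ : ℝ) (D : ℕ) : Tl σ D ≤ (Lc σ D + 2).choose 2 := by
  have h := Tl_le_mul σ D
  have h2 : (Lc σ D + 2).choose 2 = (Lc σ D + 1) * (Lc σ D + 2) / 2 := by
    rw [Nat.choose_two_right, show Lc σ D + 2 - 1 = Lc σ D + 1 by omega, Nat.mul_comm]
  omega

/-- `D² ≤ 2^k`. [folklore] -/
theorem sq_le_two_pow_kl (D : ℕ) : D ^ 2 ≤ 2 ^ kl D := Nat.le_pow_clog one_lt_two _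

/-! ### The integer models of the translates `ΦⁱP̃_D` -/

section models

variable (r s : ℚ) (β : ℝ) (Pt : ℕ → MvPolynomial (Fin 3) ℤ)

/-- The integer model `Qᵢ` of `ΦⁱP̃_D` (when it exists with the height bound of Proposition 4;
`0` otherwise). [cite: NguyenRoy2016, Proposition 4 (`ΦⁱP̃_D ∈ ℤ[X]`)] -/
def intModel (D i : ℕ) : MvPolynomial (Fin 3) ℤ :=
  if h : ∃ Q : MvPolynomial (Fin 3) ℤ, Q.IsHomogeneous D ∧
      map (Int.castRingHom ℂ) Q = Fpoly r s Pt D i ∧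
      (mvPolyHeight Q : ℝ) ≤ Real.exp (2 * (D : ℝ) ^ β) then h.choose else 0

variable {r s β Pt} {ξ η : ℂ} {σ ν : ℝ}

/-- The properties of the integer models for `i < 4⌊D^σ⌋`. [cite: NguyenRoy2016, Proposition 4] -/
theorem intModel_spec {D : ℕ} (hP : PropsAt ξ η r s σ β ν Pt D) {i : ℕ} (hi : i < 4 * Tl σ D) :
    (intModel r s β Pt D i).IsHomogeneous D ∧
      map (Int.castRingHom ℂ) (intModel r s β Pt D i) = Fpoly r s Pt D i ∧
      (mvPolyHeight (intModel r s β Pt D i) : ℝ) ≤ Real.exp (2 * (D : ℝ) ^ β) := by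
  have hex := (hP.2.2 i hi).1
  rw [intModel, dif_pos hex]
  exact hex.choose_spec

/-- `Q₀ = P̃_D`. [folklore] -/
theorem intModel_zero {D : ℕ} (hP : PropsAt ξ η r s σ β ν Pt D) (hT : 0 < Tl σ D) :
    intModel r s β Pt D 0 = Pt D := by
  have h := (intModel_spec hP (i := 0) (by omega)).2.1
  refine int_model_unique (h.trans ?_)
  rw [Fpoly, Nat.cast_zero, zero_mul, pow_zero, tau_zero_one]

/-- `‖P̃_D‖ ≤ e^{2D^β}` (height). [cite: NguyenRoy2016, Proposition 4] -/
theorem mvPolyHeight_Pt_le {D : ℕ} (hP : PropsAt ξ η r s σ β ν Pt D) (hT : 0 < Tl σ D) :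
    (mvPolyHeight (Pt D) : ℝ) ≤ Real.exp (2 * (D : ℝ) ^ β) := by
  have h := (intModel_spec hP (i := 0) (by omega)).2.2
  rwa [intModel_zero hP hT] at h

/-- The models in the shape used by the pair package: `Qᵢ ⊗ ℂ = τ_{(ir, sⁱ)} P̃_D` for `1 ≤ i ≤ D`
(`D ≤ T`). [cite: NguyenRoy2016, Proposition 4] -/
theorem hQi_of_propsAt {D : ℕ} (hP : PropsAt ξ η r s σ β ν Pt D) (hσ : 1 ≤ σ) :
    ∀ i ∈ Icc 1 D, map (Int.castRingHom ℂ) (intModel r s β Pt D i) =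
      tau (i * (r : ℂ)) ((s : ℂ) ^ i) (map (Int.castRingHom ℂ) (Pt D)) := by
  intro i hi
  have hi1 : 1 ≤ i := (mem_Icc.mp hi).1
  have hiD : i ≤ D := (mem_Icc.mp hi).2
  have hT := le_Tl hσ D
  exact (intModel_spec hP (by omega)).2.1

end models

/-! ### Memberships in the convex body `𝒞_D` -/

section body

variable {ξ η : ℂ} {r s : ℚ} {σ β ν : ℝ} {Pt : ℕ → MvPolynomial (Fin 3) ℤ}

/-- Values at translates: `(τ_{(ir,sⁱ)}P)(1, ξ + jr, ηsʲ) = P(1, ξ + (i+j)r, ηs^{i+j})`. [cite: NguyenRoy2016, §2] -/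
theorem eval_gpt_tau (i j : ℕ) (P : CX) :
    eval ![1, ξ + j * (r : ℂ), η * (s : ℂ) ^ j] (tau (i * (r : ℂ)) ((s : ℂ) ^ i) P) =
      eval ![1, ξ + ((i + j : ℕ) : ℂ) * (r : ℂ), η * (s : ℂ) ^ (i + j)] P := by
  have h := aeval_one_tau (i * (r : ℂ)) ((s : ℂ) ^ i) (ξ + j * (r : ℂ)) (η * (s : ℂ) ^ j) P
  change eval ![1, ξ + j * (r : ℂ), η * (s : ℂ) ^ j] (tau (i * (r : ℂ)) ((s : ℂ) ^ i) P) =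
    eval ![1, i * (r : ℂ) + (ξ + j * (r : ℂ)), (s : ℂ) ^ i * (η * (s : ℂ) ^ j)] P at h
  have hpt : (![1, i * (r : ℂ) + (ξ + j * (r : ℂ)), (s : ℂ) ^ i * (η * (s : ℂ) ^ j)] : Fin 3 → ℂ) =
      ![1, ξ + ((i + j : ℕ) : ℂ) * (r : ℂ), η * (s : ℂ) ^ (i + j)] := by
    ext k
    fin_cases k
    · rfl
    · simp only [Nat.cast_add, Fin.mk_one, Matrix.cons_val_one, Matrix.cons_val_zero]
      ring
    · simp only [Fin.reduceFinMk, Matrix.cons_val, pow_add]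
      ring
  rw [h, hpt]

/-- The small values of `P̃_D` in `eval` form. [cite: NguyenRoy2016, Proposition 4] -/
theorem norm_eval_Pt_le {D : ℕ} (hP : PropsAt ξ η r s σ β ν Pt D) {n : ℕ} (hn : n < 4 * Tl σ D) :
    ‖eval ![1, ξ + n * (r : ℂ), η * (s : ℂ) ^ n] (map (Int.castRingHom ℂ) (Pt D))‖ ≤
      Real.exp (-(D : ℝ) ^ ν / 2) := by
  have h := (hP.2.2 n hn).2
  rwa [aeval_eq_eval_map] at h

/-- `e^{−D^ν/2} ≤ e^{−U}` and `e^{2D^β} ≤ e^{Y}`. [folklore] -/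
theorem exp_bounds (β ν : ℝ) (D : ℕ) :
    Real.exp (-(D : ℝ) ^ ν / 2) ≤ Real.exp (-Ul ν D) ∧
      Real.exp (2 * (D : ℝ) ^ β) ≤ Real.exp (Yl β D) := by
  have h1 : 0 ≤ (D : ℝ) ^ ν := Real.rpow_nonneg (Nat.cast_nonneg _) _
  have h2 : 0 ≤ (D : ℝ) ^ β := Real.rpow_nonneg (Nat.cast_nonneg _) _
  refine ⟨Real.exp_le_exp.mpr ?_, Real.exp_le_exp.mpr ?_⟩
  · rw [Ul]; linarith
  · rw [Yl]; linarith

/-- **`P̃_D ∈ 𝒞_D`.** [cite: NguyenRoy2016, proof of Proposition 15 ("`P, Φ(P), …, Φ^D(P)` all belong to `𝒞_D`")] -/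
theorem map_Pt_mem_nrBody {D : ℕ} (hP : PropsAt ξ η r s σ β ν Pt D) (hT : 0 < Tl σ D) :
    map (Int.castRingHom ℂ) (Pt D) ∈ nrBody D ξ η (r : ℂ) (s : ℂ) (Yl β D) (Ul ν D) (Tl σ D) := by
  obtain ⟨hU, hY⟩ := exp_bounds β ν D
  refine ⟨hP.1.map _, ?_, fun i hi => ?_⟩
  · exact ((maxNorm_map_le_mvPolyHeight _).trans (mvPolyHeight_Pt_le hP hT)).trans hY
  · exact (norm_eval_Pt_le hP (by omega)).trans hU

/-- **`Qᵢ = ΦⁱP̃_D ∈ 𝒞_D` for `i < 2T`** (values at `γ_{i+j}`, `i + j < 3T`).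
[cite: NguyenRoy2016, proof of Proposition 15 (`W_D = 𝒵(Φⁱ(P); 0 ≤ i < 2T)` and `Z_D ⊆ W_D`)] -/
theorem map_intModel_mem_nrBody {D : ℕ} (hP : PropsAt ξ η r s σ β ν Pt D) {i : ℕ}
    (hi : i < 2 * Tl σ D) :
    map (Int.castRingHom ℂ) (intModel r s β Pt D i) ∈
      nrBody D ξ η (r : ℂ) (s : ℂ) (Yl β D) (Ul ν D) (Tl σ D) := by
  obtain ⟨hU, hY⟩ := exp_bounds β ν D
  obtain ⟨hhom, hmap, hht⟩ := intModel_spec hP (i := i) (by omega)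
  refine ⟨hhom.map _, ((maxNorm_map_le_mvPolyHeight _).trans hht).trans hY, fun j hj => ?_⟩
  rw [hmap, Fpoly, eval_gpt_tau]
  exact (norm_eval_Pt_le hP (by omega)).trans hU

/-- **The companion `Q ∈ 𝒞_D`** (`Q = ∑_{j=1}^D tʲ Qⱼ`, `t ≤ D²`), under the slack hypotheses
`D(D²)^D e^{2D^β} ≤ e^{Y}` and `D(D²)^D e^{−D^ν/2} ≤ e^{−U}`.
[cite: NguyenRoy2016, proof of Proposition 15 (the companion of Prop. 14 inside `𝒞_D`, cf. [R2012] Prop. 6.2)] -/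
theorem map_compQ_mem_nrBody {D : ℕ} (hP : PropsAt ξ η r s σ β ν Pt D) (hσ : 1 ≤ σ) {t : ℕ}
    (ht : t ≤ D ^ 2)
    (hnY : (D : ℝ) * ((D : ℝ) ^ 2) ^ D * Real.exp (2 * (D : ℝ) ^ β) ≤ Real.exp (Yl β D))
    (hnU : (D : ℝ) * ((D : ℝ) ^ 2) ^ D * Real.exp (-(D : ℝ) ^ ν / 2) ≤ Real.exp (-Ul ν D)) :
    map (Int.castRingHom ℂ) (compQ D (intModel r s β Pt D) t) ∈
      nrBody D ξ η (r : ℂ) (s : ℂ) (Yl β D) (Ul ν D) (Tl σ D) := by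
  have hT := le_Tl hσ D
  have hQi := hQi_of_propsAt hP hσ
  refine ⟨isHomogeneous_map_compQ (hP.1.map _) hQi t, ?_, fun i hi => ?_⟩
  · refine (maxNorm_map_compQ_le (fun j hj => ?_) ht).trans hnY
    have hj1 : 1 ≤ j := (mem_Icc.mp hj).1
    have hjD : j ≤ D := (mem_Icc.mp hj).2
    exact (maxNorm_map_le_mvPolyHeight _).trans (intModel_spec hP (by omega)).2.2
  · -- the value `Q(γ_i) = ∑ tʲ P̃(γ_{i+j})`
    rw [compQ, map_sum, map_sum]
    refine (norm_sum_le _ _).trans ?_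
    have hterm : ∀ j ∈ Icc 1 D, ‖eval ![1, ξ + i * (r : ℂ), η * (s : ℂ) ^ i]
        (map (Int.castRingHom ℂ) (((t : ℤ) ^ j) • intModel r s β Pt D j))‖ ≤
        ((D : ℝ) ^ 2) ^ D * Real.exp (-(D : ℝ) ^ ν / 2) := by
      intro j hj
      have hjD : j ≤ D := (mem_Icc.mp hj).2
      rw [map_zsmul, zsmul_eq_mul, map_mul, ← map_intCast (C : ℂ →+* CX), eval_C, norm_mul,
        Int.cast_pow, Int.cast_natCast, hQi j hj, eval_gpt_tau]
      have hn : ‖((t : ℂ)) ^ j‖ ≤ ((D : ℝ) ^ 2) ^ D := by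
        rw [norm_pow, Complex.norm_natCast]
        have ht' : (t : ℝ) ≤ (D : ℝ) ^ 2 := by exact_mod_cast ht
        rcases Nat.eq_zero_or_pos D with hD0 | hD0
        · subst hD0
          have : j = 0 := by omega
          subst this; simp
        · calc (t : ℝ) ^ j ≤ ((D : ℝ) ^ 2) ^ j := pow_le_pow_left₀ (Nat.cast_nonneg _) ht' j
            _ ≤ ((D : ℝ) ^ 2) ^ D := by
                refine pow_le_pow_right₀ ?_ hjD
                have h1 : (1 : ℝ) ≤ D := by exact_mod_cast hD0
                nlinarith
      have hji : j + i < 4 * Tl σ D := by omega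
      exact mul_le_mul hn (norm_eval_Pt_le hP hji) (norm_nonneg _) (by positivity)
    calc ∑ j ∈ Icc 1 D, ‖eval ![1, ξ + i * (r : ℂ), η * (s : ℂ) ^ i]
          (map (Int.castRingHom ℂ) (((t : ℤ) ^ j) • intModel r s β Pt D j))‖
        ≤ ∑ j ∈ Icc 1 D, ((D : ℝ) ^ 2) ^ D * Real.exp (-(D : ℝ) ^ ν / 2) := sum_le_sum hterm
      _ = (D : ℝ) * ((D : ℝ) ^ 2) ^ D * Real.exp (-(D : ℝ) ^ ν / 2) := by
          rw [sum_const, Nat.card_Icc, nsmul_eq_mul]; push_cast; ring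
      _ ≤ Real.exp (-Ul ν D) := hnU

end body

/-! ### The pair package and the selected orbit of a level -/

section level

variable {ξ η : ℂ} {r s : ℚ} {σ β ν : ℝ} {Pt : ℕ → MvPolynomial (Fin 3) ℤ}

/-- **The pair package of `(P̃_D, Q)` exists** (`D ≥ 1`, Proposition 4 at `D`, `r ≠ 0`,
`s ≠ 0, ±1`, `σ ≥ 1`). [cite: NguyenRoy2016, proof of Proposition 14] -/
theorem exists_transPkg_level {D : ℕ} (hD : 1 ≤ D) (hP : PropsAt ξ η r s σ β ν Pt D)
    (hS : SuppAt Pt D) (hσ : 1 ≤ σ) (hr : r ≠ 0) (hs0 : s ≠ 0) (hs1 : s ≠ 1) (hs2 : s ≠ -1) :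
    Nonempty (TransPkg D (Pt D) (intModel r s β Pt D)) := by
  obtain ⟨hX0, hX2⟩ := not_dvd_of_suppAt hS
  have hPt0 : map (Int.castRingHom ℂ) (Pt D) ≠ 0 := fun h =>
    hP.2.1 (MvPolynomial.map_injective _ (RingHom.injective_int _) (by rw [h, map_zero]))
  exact nonempty_transPkg hD (hP.1.map _) hPt0 hX0 hX2 hr hs0 hs1 hs2 (hQi_of_propsAt hP hσ)

/-- **The selected orbit of a level** (Proposition 15 with its two uses): a pair package `L` of
`(P̃_D, Q)` (`Q = compQ D Qᵢ t`, `t ≤ D²`) and an index `j₀` such that, with `O = orb j₀` over the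
normal number field `closureField L.coords` and `Z_D = L.algPt j₀`:
every family of tests in `𝒞_D` is small on `O` (`hO`, with the height on the favourable side) and
every integer form of degree `D` in `𝒞_D` vanishes on `conj Z_D` (`vanish`).
[cite: NguyenRoy2016, Proposition 15 and its proof] -/
structure LevelSel (ξ η : ℂ) (r s : ℚ) (σ β ν : ℝ) (Pt : ℕ → MvPolynomial (Fin 3) ℤ) (D : ℕ) where
  /-- the parameter of the companion -/
  t : ℕ
  ht : t ≤ D ^ 2
  /-- the pair package of `(P̃_D, Q)` -/
  L : PairPkg D (Pt D) (compQ D (intModel r s β Pt D) t)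
  /-- the selected index -/
  j₀ : Fin L.m
  /-- the orbit bound of Proposition 15 (test-family form, `Y' = 2D^β`) -/
  hO : ∀ f : Fin L.m → CX,
    (∀ j ∈ (L.cfg (closureField L.coords) L.mem_closureField_coords).orb j₀,
      f j ∈ nrBody D ξ η (r : ℂ) (s : ℂ) (Yl β D) (Ul ν D) (Tl σ D)) →
    ∏ j ∈ (L.cfg (closureField L.coords) L.mem_closureField_coords).orb j₀,
        ‖eval (L.α j) (f j)‖ / ‖L.α j‖ ^ D ≤
      S0 σ β ν D ^ ((2 * (D : ℝ) ^ β * (L.algPt j₀).deg + D * (L.algPt j₀).ht) /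
          (2 * (D : ℝ) ^ β * (D : ℝ) ^ 2 + D * ∑ j, (L.e j : ℝ) * habs (L.pt j))) *
        Real.exp (-(D * (L.algPt j₀).ht))
  /-- integer forms of degree `D` in `𝒞_D` vanish on `conj Z_D` -/
  vanish : ∀ R : MvPolynomial (Fin 3) ℤ, R.IsHomogeneous D →
    map (Int.castRingHom ℂ) R ∈ nrBody D ξ η (r : ℂ) (s : ℂ) (Yl β D) (Ul ν D) (Tl σ D) →
    ∀ q ∈ (L.algPt j₀).conj, eval q.rep (map (Int.castRingHom ℂ) R) = 0

/-- **The selected orbit exists** as soon as, at the level `D`: Proposition 4 holds, `S₀ < 1`,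
`Lc ≤ D`, the interpolation constant is `≤ e^Y`, and the two slack inequalities for the companion
hold (`|s| > 1`, `r ≠ 0`, `η ≠ 0`, `s ≠ ±1`, `σ ≥ 1`, `D ≥ 1`).
[cite: NguyenRoy2016, Proposition 15 and its proof] -/
theorem exists_levelSel {D : ℕ} (hD : 1 ≤ D) (hP : PropsAt ξ η r s σ β ν Pt D) (hS : SuppAt Pt D)
    (hσ : 1 ≤ σ) (hr : r ≠ 0) (hs0 : s ≠ 0) (hs1 : s ≠ 1) (hs2 : s ≠ -1) (hη : η ≠ 0)
    (hs : 1 < ‖(s : ℂ)‖) (hLD : Lc σ D ≤ D)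
    (hY : interpConst ξ η (r : ℂ) (s : ℂ) (Lc σ D) ≤ Real.exp (Yl β D))
    (hnY : (D : ℝ) * ((D : ℝ) ^ 2) ^ D * Real.exp (2 * (D : ℝ) ^ β) ≤ Real.exp (Yl β D))
    (hnU : (D : ℝ) * ((D : ℝ) ^ 2) ^ D * Real.exp (-(D : ℝ) ^ ν / 2) ≤ Real.exp (-Ul ν D))
    (hS0 : S0 σ β ν D < 1) :
    Nonempty (LevelSel ξ η r s σ β ν Pt D) := by
  obtain ⟨pkg⟩ := exists_transPkg_level hD hP hS hσ hr hs0 hs1 hs2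
  set L := pkg.pkg with hLdef
  set K : IntermediateField ℚ ℂ := closureField L.coords with hKdef
  have hK : ∀ i k, L.α i k ∈ K := L.mem_closureField_coords
  have hT0 : 0 < Tl σ D := one_le_Tl (by linarith) hD
  have hrC : (r : ℂ) ≠ 0 := by exact_mod_cast hr
  have hU : 0 ≤ Ul ν D := by
    rw [Ul]; exact div_nonneg (Real.rpow_nonneg (Nat.cast_nonneg _) _) (by norm_num)
  have hPmem := map_Pt_mem_nrBody hP hT0
  have hQmem := map_compQ_mem_nrBody hP hσ pkg.ht hnY hnU
  have hYw : (0 : ℝ) < 2 * (D : ℝ) ^ β := by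
    have : (0 : ℝ) < (D : ℝ) ^ β := Real.rpow_pos_of_pos (by exact_mod_cast hD) _
    linarith
  -- the selection (Proposition 15)
  obtain ⟨j₀, hj₀⟩ := L.exists_orb_prod_le' K hK hD hrC hη hs (Tl_le_choose σ D) hLD hU hY hPmem
    hQmem (sq_le_two_pow_kl D) hS0 hYw
  refine ⟨⟨pkg.t, pkg.ht, L, j₀, hj₀, fun R hR hmem q hq => ?_⟩⟩
  -- vanishing on `conj Z_D` from the bound at `j₀`
  have hBv : 0 < 2 * (D : ℝ) ^ β * (D : ℝ) ^ 2 + D * ∑ j, (L.e j : ℝ) * habs (L.pt j) := by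
    have h1 : (1 : ℝ) ≤ (D : ℝ) ^ 2 := by
      have : (1 : ℝ) ≤ D := by exact_mod_cast hD
      nlinarith
    have h2 : 0 ≤ (D : ℝ) * ∑ j, (L.e j : ℝ) * habs (L.pt j) :=
      mul_nonneg (Nat.cast_nonneg _) (sum_nonneg fun j _ => mul_nonneg (Nat.cast_nonneg _)
        (habs_nonneg _))
    nlinarith
  have hw : 0 < 2 * (D : ℝ) ^ β * (L.algPt j₀).deg + D * (L.algPt j₀).ht := by
    have h1 : (1 : ℝ) ≤ (L.algPt j₀).deg := by exact_mod_cast (L.algPt j₀).one_le_deg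
    have h2 : 0 ≤ (D : ℝ) * (L.algPt j₀).ht := mul_nonneg (Nat.cast_nonneg _) (AlgPt.ht_nonneg _)
    nlinarith
  -- convert `hj₀` back to the form with the height factor inside the product
  have hO'' : ∀ f : Fin L.m → CX, (∀ j ∈ (L.cfg K hK).orb j₀,
      f j ∈ nrBody D ξ η (r : ℂ) (s : ℂ) (Yl β D) (Ul ν D) (Tl σ D)) →
      ∏ j ∈ (L.cfg K hK).orb j₀,
          ‖eval (L.α j) (f j)‖ / ‖L.α j‖ ^ D * Real.exp (D * habs (L.pt j)) ≤
        S0 σ β ν D ^ ((2 * (D : ℝ) ^ β * (L.algPt j₀).deg + D * (L.algPt j₀).ht) /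
          (2 * (D : ℝ) ^ β * (D : ℝ) ^ 2 + D * ∑ j, (L.e j : ℝ) * habs (L.pt j))) := by
    intro f hf
    have h := hj₀ f hf
    have hexp : ∏ j ∈ (L.cfg K hK).orb j₀, Real.exp (D * habs (L.pt j)) =
        Real.exp (D * (L.algPt j₀).ht) := by
      rw [← L.sum_orb_habs_eq_ht K hK, mul_sum, Real.exp_sum]
    rw [prod_mul_distrib, hexp]
    have hpos : 0 < Real.exp (D * (L.algPt j₀).ht) := Real.exp_pos _
    have hE : Real.exp (-(D * (L.algPt j₀).ht)) = (Real.exp (D * (L.algPt j₀).ht))⁻¹ :=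
      Real.exp_neg _
    rw [hE, ← div_eq_mul_inv, le_div_iff₀ hpos] at h
    exact h
  exact L.eval_rep_eq_zero_of_orbit_bound K hK j₀ _ (S0_pos σ β ν D) hS0 hw hBv hO'' hR hmem hq

end level

/-! ### The three `D`-indexed suppliers of `EndgameData` -/

namespace LevelSel

variable {ξ η : ℂ} {r s : ℚ} {σ β ν : ℝ} {Pt : ℕ → MvPolynomial (Fin 3) ℤ} {D : ℕ}
  (Λ : LevelSel ξ η r s σ β ν Pt D)

/-- The subvariety `Z_D` (as an algebraic point). [cite: NguyenRoy2016, Proposition 15] -/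
def Z : AlgPt := Λ.L.algPt Λ.j₀

/-- **`Z_D ⊆ W_D`.** [cite: NguyenRoy2016, Proposition 15 ("`Z_D` … contained in `W_D`")] -/
theorem isIn (hP : PropsAt ξ η r s σ β ν Pt D) : IsIn r s σ Pt Λ.Z D := by
  rw [isIn_iff hP]
  intro i hi
  have hi' : i < 2 * Tl σ D := hi
  obtain ⟨hhom, hmap, -⟩ := intModel_spec hP (i := i) (by omega)
  have hmem := map_intModel_mem_nrBody hP hi'
  have hvan := Λ.vanish _ hhom hmem Λ.Z.1 Λ.Z.self_mem_conj
  rw [← hmap]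
  -- from the representative to the normalised coordinates
  have hnv : nv Λ.Z.1 = (Λ.Z.1.rep (pivot Λ.Z.1.rep))⁻¹ • Λ.Z.1.rep := by
    funext k
    simp [nv, nrm, div_eq_inv_mul]
  rw [hnv, eval_smul_eq_zero_iff (hhom.map _) (inv_ne_zero (apply_pivot_ne_zero Λ.Z.1.rep_nonzero))]
  exact hvan

/-- **Corollary 16 for `Z_D`, symbolic form**: with `ι(q)` a closest `γᵢ` (`i < T`) and the
points of `conj Z_D` at positive distance from the `γᵢ` (`(ξ, η) ∉ ℚ̄ × ℚ̄`),
`∑_{q ∈ conj Z_D} (Y − log(2c₁₀(L)) + log dist(q, γ_{ι q})) ≤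
  ((2D^β deg Z_D + D ht Z_D)/B) log S₀ − D ht Z_D`, `B = 2D^β·D² + D ∑ⱼ eⱼ h_abs([αⱼ])`.
[cite: NguyenRoy2016, Corollary 16 and its proof] -/
theorem cor16 (hD : 1 ≤ D) (hr : r ≠ 0) (hη : η ≠ 0) (hs0 : s ≠ 0) (hs : 1 < ‖(s : ℂ)‖)
    (hLD : Lc σ D < D) (hξη : ¬ (IsAlgebraic ℚ ξ ∧ IsAlgebraic ℚ η)) (hσ : 0 ≤ σ) :
    ∃ ι : PPt → ℕ, (∀ q, ι q < Tl σ D) ∧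
      (∀ q, ∀ i : ℕ, i < Tl σ D →
        pdist q (gamP ξ η (r : ℂ) (s : ℂ) (ι q)) ≤ pdist q (gamP ξ η (r : ℂ) (s : ℂ) i)) ∧
      ∑ q ∈ Λ.Z.conj, (Yl β D - Real.log (2 * c10 ξ η (r : ℂ) (s : ℂ) (Lc σ D)) +
          Real.log (pdist q (gamP ξ η (r : ℂ) (s : ℂ) (ι q)))) ≤
        (2 * (D : ℝ) ^ β * Λ.Z.deg + D * Λ.Z.ht) /
            (2 * (D : ℝ) ^ β * (D : ℝ) ^ 2 + D * ∑ j, (Λ.L.e j : ℝ) * habs (Λ.L.pt j)) *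
          Real.log (S0 σ β ν D) - D * Λ.Z.ht := by
  have hrC : (r : ℂ) ≠ 0 := by exact_mod_cast hr
  have hpos : ∀ q ∈ Λ.Z.conj, ∀ i : ℕ, i < Tl σ D → 0 < pdist q (gamP ξ η (r : ℂ) (s : ℂ) i) :=
    fun q hq i _ => pdist_pos_of_mem_conj_gamP ξ η r hs0 hη hξη Λ.Z hq i
  obtain ⟨ι, hιT, hιmin, hsum⟩ := Λ.L.cor16_of_orbit_bound (closureField Λ.L.coords)
    Λ.L.mem_closureField_coords Λ.j₀ hrC hη hs (one_le_Tl hσ hD) (Tl_le_mul σ D) hLD Λ.hO hpos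
  refine ⟨ι, hιT, hιmin, hsum.trans (le_of_eq ?_)⟩
  have hS := S0_pos σ β ν D
  rw [Real.log_mul (Real.rpow_pos_of_pos hS _).ne' (Real.exp_pos _).ne', Real.log_rpow hS,
    Real.log_exp]
  rfl

end LevelSel

/-! ### Proposition 14 for any `Z ⊆ W_D` -/

section prop14

variable {ξ η : ℂ} {r s : ℚ} {σ β ν : ℝ} {Pt : ℕ → MvPolynomial (Fin 3) ℤ} {D : ℕ}

/-- From `Z ⊆ W_D` (`IsIn`) to the pointwise vanishing `P̃_D(τ̲ʲ q̲) = 0` at every conjugate `q`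
of `Z` and every `j < 2T`. [cite: NguyenRoy2016, §5 (`W_D`)] -/
theorem hW_of_isIn (hP : PropsAt ξ η r s σ β ν Pt D) {Z : AlgPt} (hZ : IsIn r s σ Pt Z D) :
    ∀ q ∈ Z.conj, ∀ j : ℕ, j < 2 * Tl σ D →
      eval (tauMatPow (r : ℂ) (s : ℂ) j *ᵥ q.rep) (map (Int.castRingHom ℂ) (Pt D)) = 0 := by
  intro q hq j hj
  have hj' : j < 2 * Tl σ D := hj
  obtain ⟨hhom, hmap, -⟩ := intModel_spec hP (i := j) (by omega)
  have h1 : aeval (ap Z.1) (intModel r s β Pt D j) = 0 := hZ j hj _ hmap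
  have h2 : eval (nv q) (map (Int.castRingHom ℂ) (intModel r s β Pt D j)) = 0 :=
    (Z.eval_map_eq_zero_iff_of_mem_conj _ hq).mpr h1
  have hnv : nv q = (q.rep (pivot q.rep))⁻¹ • q.rep := by
    funext k
    simp [nv, nrm, div_eq_inv_mul]
  rw [hnv, eval_smul_eq_zero_iff (hhom.map _) (inv_ne_zero (apply_pivot_ne_zero q.rep_nonzero)),
    hmap, Fpoly, eval_tau_pow] at h2
  exact h2

/-- **Proposition 14, degree**: `deg(τⁱZ) ≤ 2 + D²/T` for `Z ⊆ W_D`. [cite: NguyenRoy2016, Proposition 14] -/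
theorem prop14_card_le (Λ : LevelSel ξ η r s σ β ν Pt D) (hP : PropsAt ξ η r s σ β ν Pt D)
    (hD : 1 ≤ D) (hσ : 1 ≤ σ) (hr : r ≠ 0) (hs0 : s ≠ 0) (hs1 : s ≠ 1) (hs2 : s ≠ -1) {Z : AlgPt}
    (hZ : IsIn r s σ Pt Z D) (i : ℤ) :
    ((Z.tauA r hs0 i).deg : ℝ) ≤ 2 + ((D : ℝ) ^ 2) / Tl σ D := by
  have h := prop14_deg_le r hs0 hr hs1 hs2 Λ.L (hQi_of_propsAt hP hσ) Z (one_le_Tl (by linarith) hD)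
    (le_Tl hσ D) (hW_of_isIn hP hZ) i
  refine h.trans ?_
  have hT : (0 : ℝ) < Tl σ D := by exact_mod_cast one_le_Tl (by linarith) hD
  have hm : (Λ.L.m : ℝ) ≤ (D : ℝ) ^ 2 := by exact_mod_cast Λ.L.hm
  gcongr

/-- **Proposition 14, height**: `ht(τⁱZ) ≤ H/(DT) + 4c₄D²` (`|i| < 3T`) for `Z ⊆ W_D`, with
`H = log 𝓛(Φ(P̃_D, Q, ·)) ≤ log N! + N₀ Y + #M₁ Y`. [cite: NguyenRoy2016, Proposition 14] -/
theorem prop14_ht_le_of_isIn (Λ : LevelSel ξ η r s σ β ν Pt D) (hP : PropsAt ξ η r s σ β ν Pt D)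
    (hD : 1 ≤ D) (hσ : 1 ≤ σ) (hr : r ≠ 0) (hs0 : s ≠ 0) (hs1 : s ≠ 1) (hs2 : s ≠ -1)
    (hnY : (D : ℝ) * ((D : ℝ) ^ 2) ^ D * Real.exp (2 * (D : ℝ) ^ β) ≤ Real.exp (Yl β D))
    {Z : AlgPt} (hZ : IsIn r s σ Pt Z D) {i : ℤ} (hi : |i| < 3 * Tl σ D) :
    (Z.tauA r hs0 i).ht ≤
      (Real.log (Fintype.card (PhiRow D)).factorial +
          Fintype.card ↥(finsuppAntidiag (univ : Finset (Fin 3)) (2 * D)) * Yl β D +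
          Fintype.card ↥Λ.L.M₁ * Yl β D) / (D * Tl σ D) +
        4 * AlgPt.c4 r s * (D : ℝ) ^ 2 := by
  have hT0 : 0 < Tl σ D := one_le_Tl (by linarith) hD
  have h := prop14_ht_le r hs0 hr hs1 hs2 hD Λ.L (hQi_of_propsAt hP hσ) Z (one_le_Tl (by linarith) hD)
    (le_Tl hσ D) (hW_of_isIn hP hZ) hi
  refine h.trans ?_
  have hDT : (0 : ℝ) < D * Tl σ D := by
    have h1 : (0 : ℝ) < D := by exact_mod_cast hD
    have h2 : (0 : ℝ) < Tl σ D := by exact_mod_cast hT0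
    exact mul_pos h1 h2
  gcongr
  -- `log 𝓛(F₀) ≤ log N! + N₀ Y + N₁ Y` with `M_P = M_Q = e^Y`
  have hY1 : 1 ≤ Real.exp (Yl β D) := Real.one_le_exp (by
    rw [Yl]; exact mul_nonneg (by norm_num) (Real.rpow_nonneg (Nat.cast_nonneg _) _))
  have hPn : maxNorm (map (Int.castRingHom ℂ) (Pt D)) ≤ Real.exp (Yl β D) :=
    (map_Pt_mem_nrBody hP hT0).2.1
  have hQn : maxNorm (map (Int.castRingHom ℂ) (compQ D (intModel r s β Pt D) Λ.t)) ≤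
      Real.exp (Yl β D) := by
    refine (maxNorm_map_compQ_le (fun j hj => ?_) Λ.ht).trans hnY
    have hj1 : 1 ≤ j := (mem_Icc.mp hj).1
    have hjD : j ≤ D := (mem_Icc.mp hj).2
    have hT := le_Tl hσ D
    exact (maxNorm_map_le_mvPolyHeight _).trans (intModel_spec hP (by omega)).2.2
  have h2 := Λ.L.length_intF_le
  have hlen1 := Λ.L.one_le_length_intF
  -- direct route: `log length ≤ log (N! (e^Y)^{N₀} (e^Y)^{N₁})`
  have hfact : (0 : ℝ) < ((Fintype.card (PhiRow D)).factorial : ℝ) :=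
    Nat.cast_pos.mpr (Nat.factorial_pos _)
  have hP0 : 0 ≤ maxNorm (map (Int.castRingHom ℂ) (Pt D)) := maxNorm_nonneg _
  have hQ0 : 0 ≤ maxNorm (map (Int.castRingHom ℂ) (compQ D (intModel r s β Pt D) Λ.t)) :=
    maxNorm_nonneg _
  have hpowP := pow_le_pow_left₀ hP0 hPn (Fintype.card ↥(finsuppAntidiag (univ : Finset (Fin 3)) (2 * D)))
  have hpowQ := pow_le_pow_left₀ hQ0 hQn (Fintype.card ↥Λ.L.M₁)
  have hlen2 : ∑ n ∈ Λ.L.intF.support, |((coeff n Λ.L.intF : ℤ) : ℝ)| ≤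
      ((Fintype.card (PhiRow D)).factorial : ℝ) *
        (Real.exp (Yl β D) ^ Fintype.card ↥(finsuppAntidiag (univ : Finset (Fin 3)) (2 * D)) *
          Real.exp (Yl β D) ^ Fintype.card ↥Λ.L.M₁) := by
    refine h2.trans (mul_le_mul_of_nonneg_left ?_ hfact.le)
    exact mul_le_mul hpowP hpowQ (pow_nonneg hQ0 _) (pow_nonneg (Real.exp_pos _).le _)
  have hpos1 : (0 : ℝ) < Real.exp (Yl β D) ^ Fintype.card ↥(finsuppAntidiag (univ : Finset (Fin 3)) (2 * D)) :=
    pow_pos (Real.exp_pos _) _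
  have hpos2 : (0 : ℝ) < Real.exp (Yl β D) ^ Fintype.card ↥Λ.L.M₁ := pow_pos (Real.exp_pos _) _
  calc Real.log (∑ n ∈ Λ.L.intF.support, |((coeff n Λ.L.intF : ℤ) : ℝ)|)
      ≤ Real.log (((Fintype.card (PhiRow D)).factorial : ℝ) *
          (Real.exp (Yl β D) ^ Fintype.card ↥(finsuppAntidiag (univ : Finset (Fin 3)) (2 * D)) *
            Real.exp (Yl β D) ^ Fintype.card ↥Λ.L.M₁)) :=
        Real.log_le_log (lt_of_lt_of_le one_pos hlen1) hlen2
    _ = Real.log ((Fintype.card (PhiRow D)).factorial : ℝ) +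
          Fintype.card ↥(finsuppAntidiag (univ : Finset (Fin 3)) (2 * D)) * Yl β D +
          Fintype.card ↥Λ.L.M₁ * Yl β D := by
        rw [Real.log_mul hfact.ne' (mul_pos hpos1 hpos2).ne', Real.log_mul hpos1.ne' hpos2.ne',
          Real.log_pow, Real.log_pow, Real.log_exp, add_assoc]

end prop14

end NguyenRoy

end Literature.NumberTheory.Transcendental
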